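import Mathlib
import Summits.Ventures.PercRepro2.Tail2D
import Summits.Ventures.PercRepro2.Tail2DExchange
import Summits.Ventures.PercRepro2.Tail2DPairSign
import Summits.Ventures.PercRepro2.Tail2DFlowTwoLemmas

/-!
# Absorption lemmas for the flow-three triangle (seat mine-b, cell pub-perc-repro2)

On the ten-point triangle `{i + j ≤ 3}` (parallel composition with a max-flow-3 factor) the exchange
defects have 55 pair coefficients; for `m1` and for `m2` fifteen are unsigned (conjectures/MINE-B.md
§33.7).  Thirteen of each have a pairwise absorber; the two ORPHANS of each — for `m2` the pairs at red
distance `3` and row difference `−1, −2` (`{(0,1),(3,0)}`, `{(0,2),(3,0)}`: the width-3 obstacle of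
§32.8 (c)), for `m1` the pairs at level distance `3` (`{(0,0),(1,2)}`, `{(0,0),(2,1)}`) — are absorbed
by a COUPLE of inner pairs, and the three-term sums COLLAPSE to a single multi-step exchange:

* `abs2_T3a`: `c₂{(0,2),(3,0)} + c₂{(1,1),(2,1)} + c₂{(1,2),(2,0)} = T(a+2,b−3)T(a−3,b) − T(a−1,b)T(a,b−3)`
  (the likelihood-ratio order of the `w`-lines through `(a−3,b)` and `(a−1,b)`, three steps);
* `abs2_T3b`: `c₂{(0,1),(3,0)} + c₂{(1,0),(2,1)} + c₂{(1,1),(2,0)} = T(a+2,b−2)T(a−3,b) − T(a,b)T(a−1,b−2)`;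
* `abs1_T3a`: `c₁{(0,0),(1,2)} + c₁{(0,1),(1,1)} + c₁{(0,2),(1,0)} = T(a+1,b+1)T(a−1,b−2) − T(a+1,b−2)T(a−1,b+1)`
  (the columns through `a−1` and `a+1`, three steps); `abs1_T3b` the mirror;
* the span-three pairs `{(0,0),(3,0)}` (`m1`, `m2`) and `{(0,0),(0,3)}` (`m1`) absorbed into
  `{(1,0),(2,0)}` resp. `{(0,1),(0,2)}`: single exchanges.

The general tools: `lines_w` (the lr-order of two `w`-lines `k` apart, iterating `m2_iter`), `cols_e2`
and `rows_e1` (the lr-order of two columns / rows, iterating `d2_e1` / `d1_e2`).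
-/

namespace Summit.Ventures.PercRepro2.Tail2D

namespace IsMTail

variable {T : ℤ → ℤ → ℝ} {L : ℤ} (hT : IsMTail T L)

include hT

/-- the likelihood-ratio order of two `w`-lines `k` apart: for `m ≤ m′`,
`T(a+k+m′, b−m′) T(a+m, b−m) ≤ T(a+k+m, b−m) T(a+m′, b−m′)` -/
lemma lines_w (a b : ℤ) (k : ℕ) {m m' : ℤ} (h : m ≤ m') :
    T (a + k + m') (b - m') * T (a + m) (b - m) ≤ T (a + k + m) (b - m) * T (a + m') (b - m') := by
  induction k with
  | zero => simp only [Nat.cast_zero, add_zero]; exact le_of_eq (mul_comm _ _)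
  | succ k ih =>
    push_cast
    rw [show a + ((k : ℤ) + 1) = a + k + 1 by ring]
    have s2 := hT.m2_iter (a + k) b h
    -- s2 : T (a + k + 1 + m') (b - m') * T (a + k + m) (b - m) ≤ T (a + k + 1 + m) (b - m) * T (a + k + m') (b - m')
    have hz : T (a + k + m) (b - m) * T (a + k + m') (b - m') = 0 →
        T (a + k + 1 + m') (b - m') * T (a + m) (b - m) ≤ T (a + k + 1 + m) (b - m) * T (a + m') (b - m') := by
      intro h0
      rcases mul_eq_zero.mp h0 with h0 | h0
      · have : T (a + k + 1 + m') (b - m') * T (a + m) (b - m) = 0 := by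
          by_contra hne
          have h1 : 0 < T (a + k + 1 + m') (b - m') :=
            lt_of_le_of_ne (hT.nonneg _ _) (fun h => hne (by rw [← h, zero_mul]))
          have h2 : 0 < T (a + m) (b - m) := lt_of_le_of_ne (hT.nonneg _ _) (fun h => hne (by rw [← h, mul_zero]))
          rw [hT.pos_iff] at h1 h2
          rw [hT.eq_zero_iff] at h0
          omega
        rw [this]; exact mul_nonneg (hT.nonneg _ _) (hT.nonneg _ _)
      · have : T (a + k + 1 + m') (b - m') = 0 :=
          le_antisymm (h0 ▸ hT.anti₁_of_le (a := a + k + m') (a' := a + k + 1 + m') (by omega) (b - m'))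
            (hT.nonneg _ _)
        rw [this, zero_mul]; exact mul_nonneg (hT.nonneg _ _) (hT.nonneg _ _)
    exact chain' (P := T (a + k + 1 + m') (b - m')) (Q := T (a + m) (b - m)) (R := T (a + k + 1 + m) (b - m))
      (S := T (a + m') (b - m')) (M := T (a + k + m) (b - m)) (N := T (a + k + m') (b - m'))
      (hT.nonneg _ _) (hT.nonneg _ _) (hT.nonneg _ _) (hT.nonneg _ _) hz ih s2

/-- the likelihood-ratio order of two columns `k` apart: for `m ≤ m′`,
`T(a+k, b+m′) T(a, b+m) ≤ T(a+k, b+m) T(a, b+m′)` -/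
lemma cols_e2 (a b : ℤ) (k : ℕ) {m m' : ℤ} (h : m ≤ m') :
    T (a + k) (b + m') * T a (b + m) ≤ T (a + k) (b + m) * T a (b + m') := by
  obtain ⟨d, rfl⟩ : ∃ d : ℕ, m' = m + d := ⟨(m' - m).toNat, by omega⟩
  induction d with
  | zero => simp only [Nat.cast_zero, add_zero]; exact le_rfl
  | succ d ih =>
    have ih' := ih (by omega)
    push_cast
    have step := hT.d2_e1 a (b + m + d) k
    -- step : T (a + k) (b + m + d + 1) * T a (b + m + d) ≤ T a (b + m + d + 1) * T (a + k) (b + m + d)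
    have hz : T (a + k) (b + m + d) = 0 → T (a + k) (b + (m + (d + 1))) * T a (b + m) = 0 := by
      intro h0
      have : T (a + k) (b + (m + (d + 1))) = 0 :=
        le_antisymm (h0 ▸ hT.anti₂_of_le (a + k) (b := b + m + d) (b' := b + (m + (d + 1))) (by omega))
          (hT.nonneg _ _)
      rw [this, zero_mul]
    have key := ratio_chain (P := T (a + k) (b + (m + (d + 1)))) (Q := T a (b + m)) (R := T (a + k) (b + m))
      (S := T a (b + (m + (d + 1)))) (M := T (a + k) (b + m + d)) (N := T a (b + m + d))
      (hT.nonneg _ _) (hT.nonneg _ _) (hT.nonneg _ _) (hT.nonneg _ _) hz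
      (by rw [show b + (m + d) = b + m + d by ring] at ih'; linarith [ih'])
      (by rw [show b + (m + (d + 1)) = b + m + d + 1 by ring]; linarith [step])
    exact key

/-- the likelihood-ratio order of two rows `k` apart: for `m ≤ m′`,
`T(a+m′, b+k) T(a+m, b) ≤ T(a+m, b+k) T(a+m′, b)` -/
lemma rows_e1 (a b : ℤ) (k : ℕ) {m m' : ℤ} (h : m ≤ m') :
    T (a + m') (b + k) * T (a + m) b ≤ T (a + m) (b + k) * T (a + m') b := by
  obtain ⟨d, rfl⟩ : ∃ d : ℕ, m' = m + d := ⟨(m' - m).toNat, by omega⟩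
  induction d with
  | zero => simp only [Nat.cast_zero, add_zero]; exact le_rfl
  | succ d ih =>
    have ih' := ih (by omega)
    push_cast
    have step := hT.d1_e2 (a + m + d) b k
    -- step : T (a + m + d + 1) (b + k) * T (a + m + d) b ≤ T (a + m + d + 1) b * T (a + m + d) (b + k)
    have hz : T (a + m + d) (b + k) = 0 → T (a + (m + (d + 1))) (b + k) * T (a + m) b = 0 := by
      intro h0
      have : T (a + (m + (d + 1))) (b + k) = 0 :=
        le_antisymm (h0 ▸ hT.anti₁_of_le (a := a + m + d) (a' := a + (m + (d + 1))) (by omega) (b + k))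
          (hT.nonneg _ _)
      rw [this, zero_mul]
    have key := ratio_chain (P := T (a + (m + (d + 1))) (b + k)) (Q := T (a + m) b) (R := T (a + m) (b + k))
      (S := T (a + (m + (d + 1))) b) (M := T (a + m + d) (b + k)) (N := T (a + m + d) b)
      (hT.nonneg _ _) (hT.nonneg _ _) (hT.nonneg _ _) (hT.nonneg _ _) hz
      (by rw [show a + (m + d) = a + m + d by ring] at ih'; linarith [ih'])
      (by rw [show a + (m + (d + 1)) = a + m + d + 1 by ring]; linarith [step])
    exact key

/-! ### the four orphan couples of the flow-three triangle -/

/-- `m2`: the pair `{(0,2),(3,0)}` (red distance 3, row difference −2) absorbed by the couple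
`{(1,1),(2,1)}`, `{(1,2),(2,0)}`: the sum collapses to the three-step `w`-exchange between the lines
through `(a−3,b)` and `(a−1,b)` -/
lemma abs2_T3a (a b : ℤ) :
    crossB T a (b - 2) (a - 3) b + crossB T (a - 3) b a (b - 2)
      + (crossB T (a - 1) (b - 1) (a - 2) (b - 1) + crossB T (a - 2) (b - 1) (a - 1) (b - 1))
      + (crossB T (a - 1) (b - 2) (a - 2) b + crossB T (a - 2) b (a - 1) (b - 2)) ≤ 0 := by
  unfold crossB
  have := hT.lines_w (a - 3) b 2 (m := 0) (m' := 3) (by norm_num)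
  push_cast at this
  ring_nf at this ⊢
  linarith [this]

/-- `m2`: the pair `{(0,1),(3,0)}` (red distance 3, row difference −1) absorbed by the couple
`{(1,0),(2,1)}`, `{(1,1),(2,0)}`: the two-step `w`-exchange between the lines through `(a−3,b)`
and `(a,b)` -/
lemma abs2_T3b (a b : ℤ) :
    crossB T a (b - 1) (a - 3) b + crossB T (a - 3) b a (b - 1)
      + (crossB T (a - 1) b (a - 2) (b - 1) + crossB T (a - 2) (b - 1) (a - 1) b)
      + (crossB T (a - 1) (b - 1) (a - 2) b + crossB T (a - 2) b (a - 1) (b - 1)) ≤ 0 := by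
  unfold crossB
  have := hT.lines_w (a - 3) b 3 (m := 0) (m' := 2) (by norm_num)
  push_cast at this
  ring_nf at this ⊢
  linarith [this]

/-- `m1`: the pair `{(0,0),(1,2)}` (level distance 3) absorbed by the couple `{(0,1),(1,1)}`,
`{(0,2),(1,0)}`: the three-step `e₂`-exchange between the columns `a−1` and `a+1` -/
lemma abs1_T3a (a b : ℤ) :
    crossB1 T a b (a - 1) (b - 2) + crossB1 T (a - 1) (b - 2) a b
      + (crossB1 T a (b - 1) (a - 1) (b - 1) + crossB1 T (a - 1) (b - 1) a (b - 1))
      + (crossB1 T a (b - 2) (a - 1) b + crossB1 T (a - 1) b a (b - 2)) ≤ 0 := by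
  unfold crossB1
  have := hT.cols_e2 (a - 1) (b - 2) 2 (m := 0) (m' := 3) (by norm_num)
  push_cast at this
  ring_nf at this ⊢
  linarith [this]

/-- `m1`: the pair `{(0,0),(2,1)}` absorbed by the couple `{(0,1),(2,0)}`, `{(1,0),(1,1)}` (the
mirror of `abs1_T3a`): the three-step `e₁`-exchange between the rows `b−1` and `b+1` -/
lemma abs1_T3b (a b : ℤ) :
    crossB1 T a b (a - 2) (b - 1) + crossB1 T (a - 2) (b - 1) a b
      + (crossB1 T a (b - 1) (a - 2) b + crossB1 T (a - 2) b a (b - 1))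
      + (crossB1 T (a - 1) b (a - 1) (b - 1) + crossB1 T (a - 1) (b - 1) (a - 1) b) ≤ 0 := by
  unfold crossB1
  have := hT.rows_e1 (a - 2) (b - 1) 2 (m := 0) (m' := 3) (by norm_num)
  push_cast at this
  ring_nf at this ⊢
  linarith [this]

/-! ### the span-three pairs -/

/-- `m1`: the pair `{(0,0),(3,0)}` absorbed into `{(1,0),(2,0)}`: a single `e₂`-exchange along `4e₁` -/
lemma abs1_S3 (a b : ℤ) :
    crossB1 T a b (a - 3) b + crossB1 T (a - 3) b a b
      + (crossB1 T (a - 1) b (a - 2) b + crossB1 T (a - 2) b (a - 1) b) ≤ 0 := by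
  unfold crossB1
  have := hT.d2_e1 (a - 3) b 4
  push_cast at this
  ring_nf at this ⊢
  linarith [this]

/-- `m1`: the pair `{(0,0),(0,3)}` absorbed into `{(0,1),(0,2)}`: a single `e₁`-exchange along `4e₂` -/
lemma abs1_S3' (a b : ℤ) :
    crossB1 T a b a (b - 3) + crossB1 T a (b - 3) a b
      + (crossB1 T a (b - 1) a (b - 2) + crossB1 T a (b - 2) a (b - 1)) ≤ 0 := by
  unfold crossB1
  have := hT.d1_e2 a (b - 3) 4
  push_cast at this
  ring_nf at this ⊢
  linarith [this]

/-- `m2`: the pair `{(0,0),(3,0)}` absorbed into `{(1,0),(2,0)}`: a single `w`-exchange along `4e₁` -/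
lemma abs2_S3 (a b : ℤ) :
    crossB T a b (a - 3) b + crossB T (a - 3) b a b
      + (crossB T (a - 1) b (a - 2) b + crossB T (a - 2) b (a - 1) b) ≤ 0 := by
  unfold crossB
  have := hT.dw_cone (a := a - 3) (b := b) (a' := a + 1) (b' := b) (by omega) le_rfl
  ring_nf at this ⊢
  linarith [this]

end IsMTail

end Summit.Ventures.PercRepro2.Tail2D
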